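import Mathlib
import HarnessLib
import HarnessLib.Audit
import Summits.QuantumAdvantage.Statement
import Literature.Computability.QuantumComplexity.StabilizerRank
import Literature.Computability.Cryptography.TCount

/-!
Route: FermionicMagic

CLOSED (retired) 2026-08-15T13:50:51Z by operator:999:1257524 — reason: not-a-thesis: assembly does not conclude the sub-problem Statement — note: D-0027 §2.1 audit (human 2026-08-15: routes that do not decide the summit are removed): the assembly concludes `NegStabrankSuperpoly`, not the sub-problem statement; a NEW conforming route may be opened from the same idea (generated `closes : … → _root_.QuantumAdvantage`).. The file is kept as the record of this route; refuted decls are indexed as negative knowledge (`ledger negatives`).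

Route FermionicMagic (realises idea card
QuantumAdvantage/QuantumAdvantage/free-fermions-certify-magic: "free fermions certify magic").
THESIS X (= crux FermiSeaApproxRank, words): there is a fixed delta in (0,1) such that the
delta-approximate stabilizer rank of the half-filled (chiral) Fermi sea FS_n is superpolynomial in n
infinitely often: for all k, N there is n >= N with n^k < chi_delta(FS_n). Here FS_n : QReg n -> C
is the Jordan-Wigner image of the Slater determinant of the k = floor(n/2) plane waves phi_a(j) =
omega_n^{a j}/sqrt(n), a = 0..k-1: its amplitude on an occupation pattern x with occupied sites j_0
< ... < j_{k-1} is det[phi_a(j_b)]_{a,b<k} = n^{-k/2} prod_{b<b'} (omega^{j_b'} - omega^{j_b}) (a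
discrete beta=2 Coulomb gas; unit norm by Cauchy-Binet; max |amp|^2 = 2^{-n/2}), and 0 off the
k-particle sector. Conventions (rows a ascending, columns = occupied sites ascending) were checked
numerically against prod_a psi^dagger(phi_a)|vac> for n = 4, 6.
Lean (X, one line over existing decls, inlined Slater determinant; elaborates rc 0): `∃ δ : ℝ, 0 < δ
∧ δ < 1 ∧ ∀ k N : ℕ, ∃ n : ℕ, N ≤ n ∧ n ^ k <
Literature.Computability.QuantumComplexity.approxStabilizerRank δ (fun x : QReg n => if h :
(univ.filter fun j => x j = true).card = n / 2 then (Matrix.of fun a b : Fin (n / 2) => Complex.exp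
(2πi·a·(S.orderEmbOfFin h b)/n) / √n).det else 0)`.
IT SUFFICES (X -> the kill statement): the route is NEGATIVE-SIDE. Its conclusion is
NegStabrankSuperpoly = verbatim the statement of item stmt-QuantumAdvantage-0247 (Dequantize's ¬crux
DeqNegStabrankSuperpoly: ∃ δ ∈ (0,1) ∀ c ∃ t, t^c + c < chi_delta(|T>^{⊗t})), which refutes
hypothesis (a) of Dequantize #2 / 0470 and closes the stabilizer-rank road to ¬QuantumAdvantage; it
proves nothing about S itself. The bridge is Mehraban-Tahmasbi's injection argument
(arXiv:2305.10277 §3) with the Haar-random target REPLACED by the structured, cheaply preparable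
FS_n:
  Assembly := ApproxGadgetTransfer (MT24 Lemma 3.6: chi_delta(U|0^N>) <= chi_delta(|T>^{⊗ tCount U})
for every oracle-free Clifford+T circuit U, same delta) -> AncillaDrop (MT24 §3.4(a): chi_delta(psi)
<= chi_delta(psi ⊗ |0^m>)) -> ApproxRankPerturb (triangle inequality: ||psi - psi'|| <= eps ⟹
chi_{delta+eps}(psi) <= chi_delta(psi')) -> FermiSeaPrep (for every eps > 0 a polynomial T-count
a(eps)(n+1)^{a(eps)} Clifford+T circuit prepares FS_n ⊗ |0^m> to precision eps: Givens/fermionic-FFT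
network + Solovay-Kitaev on fixed-size blocks; VerstraeteCiracLatorre2009, Ferris2014,
JiangEtAl2018, KivlichanEtAl2018, tree `exists_placementWord`) -> FermiSeaApproxRank ->
NegStabrankSuperpoly.
The Assembly is PROVED from its five antecedents in the planner's sketch (pure logic + the
arithmetic "a(n+1)^a-bounded T-count is eventually below n^k"; rc 0, no sorry), so the route's
logical skeleton is machine-checked; what remains are the five antecedents, of which only X is open
mathematics.
SECOND FAMILY (planner's typed variant of the same mechanism, chosen for EXACT preparability): the
half-filled Fermi sea CS_r of free fermions hopping on the hypercube Q_r (n = 2^r qubits = sites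
F_2^r; orbitals = Walsh characters chi_a(j) = (-1)^{a·j}/sqrt(n) with 2|a| < r, i.e. the Hamming
ball below the Fermi level; the object of BernardCrampeVinet2023; amplitudes = |K| x |K| minors of
the Sylvester-Hadamard matrix / n^{|K|/2}, nonzero iff the occupied set is unisolvent for
multilinear polynomials of degree < r/2) is prepared EXACTLY by a Clifford+T circuit of T-count <=
r·2^r = n log2 n: the fermionic Walsh-Hadamard butterfly (r layers of 2^{r-1} two-mode Hadamard beam
splitters, VerstraeteCiracLatorre2009), each beam splitter being the matchgate 1 ⊕ H ⊕ (-1) =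
CNOT·(X CZ X)·(Z Z CH Z)·CNOT with CH = (I⊗A)CZ(I⊗A^†), A = S H T H S^†, T-count 2 (identities
verified numerically, exact). Hence BOTH ranks of CS_r transfer losslessly, with no synthesis and no
ancilla:
  CubeHorn := ApproxGadgetTransfer -> CubeSeaPrep -> CubeSeaApproxRank -> NegStabrankSuperpoly (a
second, lighter line to 0247);
  ExactHorn := CubeSeaExactRank -> ExactGadgetTransfer (= tree fact
BravyiGosset2016_stabilizerRank_output_le, restated) -> CubeSeaPrep -> NegExactStabrankPoly
(superpolynomial EXACT stabilizer rank of |T>^{⊗t}: the current record is ~quadratic, PSV22/MT24;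
known only conditionally, MT24 Thm 1.6).
Both glue statements are proved in the sketch as well. Elegance: the two classically simulable
corners of quantum computing — Clifford and free fermions — are each other's hard instances; a
Slater determinant certifies magic.

Rationale: WHY THIS LINE. MehrabanTahmasbi2024 (arXiv:2305.10277) prove chi_delta(|T>^{⊗m}) = Ω̃(m^2) in three
steps — TRANSFER (Lemma 3.6: chi_delta is monotone under the T-gadgets, valid for |T> by
balancedness), TARGET (a Haar-random n-qubit state has chi_delta >= 2^n/poly, Lemma 3.2),
PREPARATION (Haar states cost t = Θ̃(2^{n/2}) T gates, LowKliuchnikovSchaeffer2024) — and the bound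
stops at t^2 exactly because the target has entropy but no structure (p.4: "the main bottleneck";
p.8 Conj 1.3 invites any low-T-count/high-rank construction). This route swaps the TARGET for
maximally structured explicit states of near-LINEAR T-cost: Slater determinants (free fermions under
Jordan-Wigner). Their amplitudes are DETERMINANTS — P-computable yet representation-rigid,
magnitudes spread over exponentially many scales, closed under Z-measurement restriction (Slater ->
Slater), covariant under the qubit-permutation symmetries of the lattice — as far from "quadratic
phase on an affine subspace" (the stabilizer dictionary used by PelegShpilkaVolk2022/Labib2022) as
algebra allows, while |T>^{⊗n}, a symmetric function of Hamming weight, is the worst target for such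
lower bounds (MT24 p.5: for functions in P the record is Williams' linear / MT24's quadratic).
Imported area: free-fermion / fermionic-linear-optics structure (determinantal point processes,
Plücker coordinates, Reed-Muller-type unisolvence on the cube) brought to bear on stabilizer-rank
lower bounds; physical evidence: stabilizer Rényi entropies of Gaussian states are extensive with
the Haar leading coefficient (ColluraEtAl2026), extensive magic of free-fermion ground states
(OlivieroLeoneHamma2022).
RANKED CRUXES.
 rank 2 FermiSeaApproxRank (= X): chi_delta(FS_n) superpolynomial for a fixed delta < 1 (ring,
card's Conjecture FS in its weak form; exponential 2^{Ω(n)} is the belief). Why it might fail: may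
be false (free-fermion states are classically easy, so NO complexity collapse protects it, unlike
T-powers), and overlap/extent arguments stop at the bounded-coefficient problem (KalraSinha2026);
any n^{2+eps} bound would already be the first super-quadratic bound for an explicit P-computable
target.
 rank 3 CubeSeaExactRank: EXACT stabilizer rank of the hypercube Fermi sea CS_r superpolynomial in n
= 2^r. The tractable horn (exact-rank technology exists: PSV22 §3, LovitzSteffan2022, Labib2022)
with a record payoff via ExactHorn. Why it might fail: everything is F_2-aligned (sites F_2^r,
orbitals = characters, K = Hamming ball; V_K is Reed-Muller-like with transitive affine symmetry)
and subgroup-like K give STABILIZER product states (K a half-space -> Bell pairs), so hidden short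
decompositions are conceivable; the r = 3 instance has a 58-point support with two magnitude classes
and cannot discriminate.
 rank 4 CubeSeaApproxRank: the approximate version for CS_r; with CubeSeaPrep it gives 0247 by the
three-line CubeHorn (no synthesis, no ancilla). Why it might fail: as rank 2 and rank 3 combined; no
magic diagnostics in print for CS_r.
SUPPORT (in print or routine; all typed, rc 0): ApproxGadgetTransfer (MT24 L3.6), AncillaDrop (MT24
§3.4(a)), ApproxRankPerturb (triangle inequality), FermiSeaPrep (Givens/FFFT + SK, poly T-count for
each eps), CubeSeaPrep (exact, T-count <= r 2^r, planner-verified identities), ExactGadgetTransfer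
(BravyiGosset2016 §II / BBCCGH19 eq.(16); same statement as the tree fact, restated to keep the
import cone free of StabilizerSimulation.lean's unproved facts), NegExactStabrankPoly (conclusion of
the exact horn), ExactHorn + CubeHorn + Assembly (glue; all three proved in the sketch), target
NegStabrankSuperpoly (= 0247 verbatim).
KILL CRITERIA. (i) chi(FS_n) <= poly(n) for the EXACT rank already refutes FermiSeaApproxRank
(chi_delta <= chi): a refuter can aim there; (ii) chi(CS_r) <= poly refutes both cube cruxes -> if
(i) and (ii) the route closes `refuted`; (iii) numerics (n <= 12 ring; r = 3 cube): rank-<=poly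
least-squares fits whose error IMPROVES with n, or stabilizer fidelity decaying slower than
exponentially, are evidence for the poly horn (then the honest output is a SIMULATION theorem: cheap
stabilizer decompositions of free-fermion states) — evidence, not a kill; (iv)
ApproxGadgetTransfer/CubeSeaPrep false AS TYPED (conventions) -> restate, never a kill.
NOT DECOMPOSED YET (depth is earned by splits once a crux shows life): the restriction-closure
induction for FS_n (measure occupations, Slater -> Slater, average over the dihedral
qubit-permutation symmetry); an exact-rank lower bound scheme for CS_r via linear independence of
restrictions to subcubes (Plücker relations vs quadratic forms); the exponential form 2^{Ω(n)} and
the near-linear T-count Õ(n) version of FermiSeaPrep (FFFT + RossSelinger2016) that would upgrade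
0247 to chi_delta(T^t) >= 2^{Ω̃(t)}; the card's dual F4 (Gaussian rank of graph states; partly known
per audit: GHZ_4 Gaussian extent, DiasKoenig2024/CudbyStrelchuk2023) is deliberately NOT filed;
numerics (stabilizer fidelity / small-rank fits of FS_n, n <= 12) are left to refuters with kit
access. Definition request filed: slaterState (general JW Slater determinant state) to replace the
inlined lambdas at the next restate.
NOVELTY / BARRIERS: see the dedicated header fields (card audit grade: new-combination; planner's
delta: the exactly-preparable hypercube family with its loss-free exact AND approximate transfer,
and the machine-checked three-horn skeleton).
SOURCES: MehrabanTahmasbi2024 (arXiv:2305.10277: L3.2, L3.6, L3.8, §3.4, Thm 1.4/1.6, Conj 1.3),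
PelegShpilkaVolk2022 (arXiv:2106.03214), Labib2022, LovitzSteffan2022, KalraSinha2026
(arXiv:2503.04101), BravyiGosset2016, BravyiEtAl2019, BravyiSmithSmolin2016,
QassimPashayanGosset2021, ColluraEtAl2026 (arXiv:2412.05367), OlivieroLeoneHamma2022,
BernardCrampeVinet2023 (arXiv:2103.15742), VerstraeteCiracLatorre2009 (arXiv:0804.1888), Ferris2014,
JiangEtAl2018, KivlichanEtAl2018, LowKliuchnikovSchaeffer2024, RossSelinger2016, GilesSelinger2013,
DawsonNielsen2006, JozsaMiyake2008, TerhalDiVincenzo2004, DiasKoenig2024,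
ReardonsmithOszmaniecKorzekwa2024, CudbyStrelchuk2023; tree: StabilizerRank.lean
(approxStabilizerRank, stabilizerRank, tensorPow, magicT), TCount.lean, StabilizerSimulation.lean
(fact BravyiGosset2016_stabilizerRank_output_le), PlacementSolovayKitaev.lean
(exists_placementWord); route Dequantize items 0244/0247/0470.

Novelty: NOVELTY (searched 2026-08-15). Card audit (refuter-novelty-audit-6): arXiv x12 queries ('stabilizer
rank Slater determinant' = 0 hits; nonstabilizerness fermionic Gaussian; Gaussian extent of
stabilizer states; Cliffords+matchgates), `lit galaxy search "stabilizer rank" --star all`, `lit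
read` of arXiv:2305.10277 pp.4-5,8,16, arXiv:2307.12912 pp.24-25, arXiv:2410.10068,
arXiv:2412.05367, arXiv:2509.10700 -> grade new-combination. This planner: `lit read
arxiv:2305.10277` pp.4,5,13-15 (Lemma 3.2/3.5/3.6/3.8, §3.4(a), Thm 1.4, Thm 1.6, Conj 1.3, Cor
3.10); `lit galaxy search "stabilizer rank" --star pdf` (11 docs: Pashayan et al 2101.12223,
BBCCGH19, Labib thesis, Dias-Koenig q-2024-05-21-1350, Sutcliffe-Kissinger 2403.10964, Lovitz
project description, Oberwolfach 49/2021 — none uses free-fermion states as hard instances), `lit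
galaxy search "stabilizer rank of Gaussian states" / "nonstabilizerness of free fermion" --star all`
(0/0 hits), `lit galaxy search "Gaussian extent" --star pdf` (only Dias-Koenig), `lit search
--source crossref` x5 ("nonstabilizerness fermionic Gaussian states" -> Collura-De Nardis-Alba-Lami
Quantum 10:2036 (2026) = arXiv:2412.05367, Mele-Herasymenko PRX Quantum 6:010319; "stabilizer rank
lower bound ..." -> PSV22 q-2022-02-15-652, Labib22, Lovitz-Steffan22, MT24 STOC
doi:10.1145/3618260.3649733, Qassim-Pashayan-Gosset21; "free fermions ... hypercube" and
"entanglement of free fermions on Hamming graphs" -> Bernard-Crampe-Vinet NPB 986:116061 (2023), P  [refs: 10.1145/3618260.3649733, 2305.10277, 2307.12912, 2410.10068, 2412.05367, 2509.10700, 2607.08396, 2307.12702, 2307.12654, arxiv:2305.10277, doi:10.1145/3618260.3649733, arxiv:2607.08396, MehrabanTahmasbi2024, ColluraEtAl2026, OlivieroLeoneHamma2022, DiasKoenig2024, ReardonsmithOszmaniecKorzekwa2024, CudbyStrelchuk2023, BernardCrampeVinet2023, VerstraeteCiracLatorre2009, Ferris2014, JiangEtAl2018, K]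

Barriers (technique_class: stabilizer-rank, lower-bound, free-fermions, determinantal): Literature.Barriers.QuantumAdvantage.SeparationPrerequisites: NOT engaged — the route is
negative-side: its conclusions (NegStabrankSuperpoly = item 0247, NegExactStabrankPoly) are resource
lower bounds for explicit states that kill the stabilizer-rank road to ¬QuantumAdvantage; no class
separation (BQP ⊄ BPP, PP ⊄ BPP, P ≠ PSPACE) is derived or claimed, so the prerequisite chain does
not bind.
Literature.Barriers.QuantumAdvantage.Relativization: NOT engaged — every statement is about explicit
state vectors (Slater determinants, |T>^{⊗t}) and explicit oracle-free Clifford+T gate lists;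
nothing quantifies over oracles, and stabilizer rank has no relativized analogue; the transfer lemma
consumes the gate list gate by gate (T-gadgets), a non-black-box argument.
Literature.Barriers.QuantumAdvantage.Algebrization: NOT engaged for the same reason (no
inclusion/separation of relativized classes, no arithmetization); the algebra used (determinants,
Plücker coordinates, quadratic forms over F_2) concerns amplitudes of fixed states, not low-degree
extensions of oracles.
Literature.Barriers.QuantumAdvantage.NaturalProofs: informative only — a stabilizer-rank lower bound
for ONE explicit state family is a 'useful property' against stabilizer decompositions, not a
constructive LARGE property against P/poly circuits; Razborov-Rudich does not apply (no
pseudorandom-function candidate lives in the class 'span of poly many stabilizer states' that the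
property must avoid — and if one did, that

Novelty grade: new-combination — ROUTE REVIEW (refuter H-73635f31, 2026-08-15). Grade follows the card audit (new-combination: MT24 transfer × determinantal free-fermion targets; planner's delta = the exactly Clifford+T-preparable hypercube Fermi sea CS_r with loss-free exact AND approximate transfer). Route already saturated (grou (refuter refuter-rreview-route-QuantumAdvantage-H-73635f31-0, 2026-08-15T12:22:14Z; prior: arXiv:2305.10277 Mehraban–Tahmasbi 2024 (L3.2/3.6/3.8, §3.4, Thm 1.4/1.6, Conj 1.3) — transfer scheme; route swaps the Haar TARGET for Slater determinants, arXiv:2106.03214 PSV22; Labib 2022; Lovitz–Steffan arXiv:2110.07781; Kalra–Sinha arXiv:2503.04101 (rank toolbox, quadratic ceiling), arXiv:2412.05367 Collura et al.; Oliviero–Leone–Hamma PRA 106 042426 (free-fermion magic at SRE/fidelity level )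

History (route lifecycle, newest last):
- 2026-08-15T13:50:51Z · CLOSED retired — not-a-thesis: assembly does not conclude the sub-problem Statement (operator:999:1257524)

sub-problem: QuantumAdvantage · status: closed(retired) · opened planner-plancard-QuantumAdvantage-QuantumAdva-a941ccb8-0 2026-08-15T11:04:40Z · rev 0 · ledger route-QuantumAdvantage-FermionicMagic
GENERATED by the gate from the ledger (D-0016/17). Provers cite these decls: `theorem foo : Summit.QuantumAdvantage.QuantumAdvantage.Theses.FermionicMagic.<Decl> := …` in Summits/QuantumAdvantage/QuantumAdvantage/Theorems/<Name>.lean.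
-/

namespace Summit.QuantumAdvantage.QuantumAdvantage.Theses.FermionicMagic

open scoped BigOperators Topology Manifold Classical MeasureTheory ProbabilityTheory Matrix InnerProductSpace ComplexConjugate ContinuousMap
open Filter Set Function TopologicalSpace MeasureTheory

attribute [summit_statement] _root_.QuantumAdvantage

open Literature.QuantumAdvantage

/-- item stmt-QuantumAdvantage-0247 · target · rank 0 · open · by planner
why it might fail: May be false (poly χ_δ(T^t) for every δ<1 is not excluded; upper bound 2^{0.396t}); unconditionally only Ω̃(t²) is known (MT24 Thm 1.1), superpolynomial only conditionally (MT24 Thm 1.6/1.11).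
sources: MehrabanTahmasbi2024 = arXiv:2305.10277 Thm 1.1, Thm 1.6, Conj 1.3, PelegShpilkaVolk2022 = arXiv:2106.03214 Thm 1.1-1.2, BravyiEtAl2019 = arXiv:1808.00128 p.6, eq.(6), tree: Literature.Computability.QuantumComplexity.approxStabilizerRank (StabilizerRank.lean); item stmt-QuantumAdvantage-0247
NEGATION of the hypothesis half of #2 (filed so the S-side is staffed): ∃ δ ∈ (0,1) such that for
every polynomial q there is t with χ_δ(|T⟩^{⊗t}) > q(t). OPEN; the best lower bounds in print are
Ω-polynomial of degree ≤ 2 (PelegShpilkaVolk2022 via higher-order Fourier analysis / quadratic phase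
structure of stabilizer states, Labib2022, MehrabanTahmasbi2024 probabilistic method). Proving it
kills crux #2 of Dequantize (does NOT prove QuantumAdvantage). Imported field: additive
combinatorics (Gowers U³ inverse theory over 𝔽₂ⁿ). NEEDS DEFINITION: approxStabilizerRank.
[needs_definition: approxStabilizerRank] -/
@[route_item "route-QuantumAdvantage-FermionicMagic"]
def NegStabrankSuperpoly : Prop :=
  ∃ δ : ℝ, 0 < δ ∧ δ < 1 ∧ ∀ c : ℕ, ∃ t : ℕ, t ^ c + c < Literature.Computability.QuantumComplexity.approxStabilizerRank δ (Literature.Computability.QuantumComplexity.tensorPow Literature.Computability.QuantumComplexity.magicT t)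

/-- item stmt-QuantumAdvantage-2476 · crux · rank 2 · closed · moot by None · by planner
why it might fail: May be FALSE: free-fermion states are classically easy, so no complexity collapse protects large rank (unlike T-powers); overlap/extent methods stall at the bounded-coefficient gap (KalraSinha2026); even n^{2+ε} would beat every explicit-target bound in print (MT24 Thm 1.4).
sources: MehrabanTahmasbi2024 = arXiv:2305.10277 p.4 (bottleneck), p.5 Thm 1.4, p.8 Conj 1.3/§1.5, PelegShpilkaVolk2022 = arXiv:2106.03214 Thm 1.2 (Ω̃(√n) approximate), §1.5, ColluraEtAl2026 = arXiv:2412.05367 (SRE of fermionic Gaussian states extensive, Haar coefficient), OlivieroLeoneHamma2022 (doi:10.1103/PhysRevA.106.042426), KalraSinha2026 = arXiv:2503.04101 Cor 3, tree: approxStabilizerRank, stabilizerStates (StabilizerRank.lean)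
[crux] THESIS X (card's Conjecture FS, weak/superpolynomial form): ∃ δ ∈ (0,1) ∀ k N ∃ n ≥ N, n^k <
χ_δ(FS_n), where FS_n : QReg n → ℂ (inlined lambda; definition request slaterState filed): FS_n(x) =
det[exp(2πi·a·j_b/n)/√n]_{a,b<k}, k = ⌊n/2⌋, if x has exactly k ones, at sites j_0<…<j_{k-1} (rows a
ascending, columns = occupied sites ascending; `Finset.orderEmbOfFin`), else 0; =
n^{-k/2}·∏_{b<b'}(ω^{j_{b'}}−ω^{j_b}); unit norm (Cauchy–Binet); = Jordan–Wigner image of ∏_{a<k}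
ψ†(φ_a)|vac⟩ with c_j† = Z_0⋯Z_{j-1}σ_j^+, qubit value true = occupied (checked numerically, n = 4,
6). Belief: χ_δ(FS_n) ≥ 2^{Ω(n)}. Intended mechanism: a DIRECT rank argument — Slater determinants
are closed under Z-measurement restriction (occupation measurement leaves a Slater determinant on
the other modes), the family is covariant under the dihedral qubit-permutation symmetry, and
determinantal amplitude patterns (magnitudes on exponentially many scales, Vandermonde signs) are
maximally far from the stabilizer dictionary 'i^{ℓ(x)}(−1)^{q(x)}·1_A(x)'; avoid the overlap→rank
(bounded-coefficient) route. Any bound n^{2+ε} is already the first super-quadratic approximate-rank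
bound for an explicit P-computa -/
@[route_item "route-QuantumAdvantage-FermionicMagic"]
def FermiSeaApproxRank : Prop :=
  ∃ δ : ℝ, 0 < δ ∧ δ < 1 ∧ ∀ k N : ℕ, ∃ n : ℕ, N ≤ n ∧ n ^ k < Literature.Computability.QuantumComplexity.approxStabilizerRank δ (fun x : Literature.Computability.Cryptography.QReg n => if h : (Finset.univ.filter fun j : Fin n => x j = true).card = n / 2 then (Matrix.of fun a b : Fin (n / 2) => Complex.exp (2 * (Real.pi : ℂ) * Complex.I * ((a : ℕ) : ℂ) * ((((Finset.univ.filter fun j : Fin n => x j = true).orderEmbOfFin h b : Fin n) : ℕ) : ℂ) / (n : ℂ)) / (Real.sqrt (n : ℝ) : ℂ)).det else 0)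

/-- item stmt-QuantumAdvantage-2477 · crux · rank 3 · closed · moot by None · by planner
why it might fail: All is F_2-aligned (sites F_2^r, orbitals = characters, K = Hamming ball, V_K Reed–Muller-like with transitive affine symmetry); subgroup-like K give STABILIZER product states (half-space K → Bell pairs), so a hidden short decomposition is conceivable; r = 3 (58-point support) cannot discriminate.
sources: PelegShpilkaVolk2022 = arXiv:2106.03214 Thm 1.1 (Ω(n) exact, the method to adapt), LovitzSteffan2022 = arXiv:2110.07781, Labib2022 = arXiv:2107.10551, BernardCrampeVinet2023 = doi:10.1016/j.nuclphysb.2022.116061 (arXiv:2103.15742): free fermions on H(r,2), MehrabanTahmasbi2024 = arXiv:2305.10277 Thm 1.6, tree: stabilizerRank (StabilizerRank.lean)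
[crux] EXACT stabilizer rank of the hypercube Fermi sea is superpolynomial: ∀ k N ∃ r ≥ N, (2^r)^k <
χ(CS_r), where CS_r : QReg (2^r) → ℂ (inlined lambda): sites j ∈ Fin 2^r read as r-bit strings, K =
{a : 2·popcount(a) < r} ascending (popcount via `(Nat.digits 2 a).sum`, a·j via `Nat.land`), CS_r(x)
= det[(−1)^{popcount(a_p AND j_q)}/√(2^r)]_{p,q<|K|} if x has exactly |K| ones at sites j_0<…, else
0; r odd ⇒ |K| = 2^{r−1} (half filling; unique ground state of hopping on the hypercube Q_r,
BernardCrampeVinet2023); amplitudes = |K|×|K| minors of the Sylvester–Hadamard matrix over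
2^{r|K|/2}, nonzero iff the occupied set is unisolvent for multilinear polynomials of degree < r/2
(r = 3: support 58/70, |amp| ∈ {1/8, 1/4}; checked numerically r = 2, 3). The tractable horn:
exact-rank lower-bound technology exists (PSV22 §3 restriction/derivative method, LovitzSteffan2022,
Labib2022) and CS_r is EXACTLY Clifford+T-preparable (CubeSeaPrep), so via ExactHorn any
superpolynomial bound here gives superpolynomial EXACT rank of |T⟩^{⊗t} (record ~quadratic;
conditional on perm ∉ P/poly by MT24 Thm 1.6). Symmetry: CS_r is invariant up to sign under the
hypercube automorphisms F_2^r ⋊ S_r acting -/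
@[route_item "route-QuantumAdvantage-FermionicMagic"]
def CubeSeaExactRank : Prop :=
  ∀ k N : ℕ, ∃ r : ℕ, N ≤ r ∧ (2 ^ r) ^ k < Literature.Computability.QuantumComplexity.stabilizerRank (fun x : Literature.Computability.Cryptography.QReg (2 ^ r) => if h : (Finset.univ.filter fun j : Fin (2 ^ r) => x j = true).card = (Finset.univ.filter fun a : Fin (2 ^ r) => 2 * (Nat.digits 2 (a : ℕ)).sum < r).card then (Matrix.of fun p q => (-1 : ℂ) ^ (Nat.digits 2 ((((Finset.univ.filter fun a : Fin (2 ^ r) => 2 * (Nat.digits 2 (a : ℕ)).sum < r).orderEmbOfFin rfl p : Fin (2 ^ r)) : ℕ) &&& (((Finset.univ.filter fun j : Fin (2 ^ r) => x j = true).orderEmbOfFin h q : Fin (2 ^ r)) : ℕ))).sum / (Real.sqrt (2 ^ r : ℝ) : ℂ)).det else 0)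

/-- item stmt-QuantumAdvantage-2478 · crux · rank 4 · closed · moot by None · by planner
why it might fail: Inherits both risks: may be false for F_2-structural reasons (see CubeSeaExactRank) and, if true, needs an approximate-rank technique beyond extent/fidelity (bounded-coefficient gap, KalraSinha2026); no magic diagnostics for CS_r exist in print.
sources: MehrabanTahmasbi2024 = arXiv:2305.10277 Lemma 3.6, Conj 1.3, Cor 3.10, ColluraEtAl2026 = arXiv:2412.05367, KalraSinha2026 = arXiv:2503.04101, BernardCrampeVinet2023 (arXiv:2103.15742), tree: approxStabilizerRank_le_stabilizerRank (StabilizerRank.lean)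
[crux] APPROXIMATE stabilizer rank of the hypercube Fermi sea is superpolynomial for a fixed δ ∈
(0,1): ∃ δ ∀ k N ∃ r ≥ N, (2^r)^k < χ_δ(CS_r) (CS_r as in CubeSeaExactRank: CS_r : QReg (2^r) → ℂ
(inlined lambda): sites j ∈ Fin 2^r read as r-bit strings, K = {a : 2·popcount(a) < r} ascending
(popcount via `(Nat.digits 2 a).sum`, a·j via `Nat.land`), CS_r(x) = det[(−1)^{popcount(a_p AND
j_q)}/√(2^r)]_{p,q<|K|} if x has exactly |K| ones at sites j_0<…, else 0; r odd ⇒ |K| = 2^{r−1}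
(half filling; unique ground state of hopping on the hypercube Q_r, BernardCrampeVinet2023);
amplitudes = |K|×|K| minors of the Sylvester–Hadamard matrix over 2^{r|K|/2}, nonzero iff the
occupied set is unisolvent for multilinear polynomials of degree < r/2 (r = 3: support 58/70, |amp|
∈ {1/8, 1/4}; checked numerically r = 2, 3).) With ApproxGadgetTransfer and the EXACT preparation
CubeSeaPrep this yields 0247 by the three-line CubeHorn — no gate synthesis, no ancilla, no
ε-bookkeeping. Implies CubeSeaExactRank (χ_δ ≤ χ, tree lemma
approxStabilizerRank_le_stabilizerRank). [MehrabanTahmasbi2024 L3.6, Conj 1.3; ColluraEtAl2026] -/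
@[route_item "route-QuantumAdvantage-FermionicMagic"]
def CubeSeaApproxRank : Prop :=
  ∃ δ : ℝ, 0 < δ ∧ δ < 1 ∧ ∀ k N : ℕ, ∃ r : ℕ, N ≤ r ∧ (2 ^ r) ^ k < Literature.Computability.QuantumComplexity.approxStabilizerRank δ (fun x : Literature.Computability.Cryptography.QReg (2 ^ r) => if h : (Finset.univ.filter fun j : Fin (2 ^ r) => x j = true).card = (Finset.univ.filter fun a : Fin (2 ^ r) => 2 * (Nat.digits 2 (a : ℕ)).sum < r).card then (Matrix.of fun p q => (-1 : ℂ) ^ (Nat.digits 2 ((((Finset.univ.filter fun a : Fin (2 ^ r) => 2 * (Nat.digits 2 (a : ℕ)).sum < r).orderEmbOfFin rfl p : Fin (2 ^ r)) : ℕ) &&& (((Finset.univ.filter fun j : Fin (2 ^ r) => x j = true).orderEmbOfFin h q : Fin (2 ^ r)) : ℕ))).sum / (Real.sqrt (2 ^ r : ℝ) : ℂ)).det else 0)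

/-- item stmt-QuantumAdvantage-2479 · support · rank 5 · closed · moot by None · by planner
sources: MehrabanTahmasbi2024 = arXiv:2305.10277 Lemma 3.6, 3.7, 3.8, BravyiGosset2016 = arXiv:1601.07601 §II, BravyiEtAl2019 = arXiv:1808.00128 §2.3.1 eq.(16), AaronsonGottesman2004 §III (measurement of stabilizer states)
[support] Mehraban–Tahmasbi Lemma 3.6 over the tree: for every oracle-free Clifford+T circuit U on N
wires and every δ, χ_δ(U|0^N⟩) ≤ χ_δ(|T⟩^{⊗ tCount U}) (same δ; the oracle argument A of toMatrix is
irrelevant for oracle-free U). Proof in print: replace each T by the state-injection gadget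
CNOT·(measure)·S-correction consuming one copy of |T⟩ = T H|0⟩ (magicT); outcomes are uniform (Lemma
3.7, balancedness |⟨0|T⟩| = |⟨1|T⟩|), and for a balanced qubit measurement min_b χ_δ(φ_b) ≤ χ_δ(φ)
after renormalisation by √2 (Lemma 3.8: split the approximant ψ = ψ_0⊗|0⟩ + ψ_1⊗|1⟩, Pythagoras,
project each stabilizer term by I⊗⟨b| — stabilizer states go to multiples of stabilizer states or
0); Clifford unitaries preserve χ_δ; start from χ_δ(|0^n⟩⊗|T⟩^{⊗k}) ≤ χ_δ(|T⟩^{⊗k}). Formalisation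
needs the Pauli-stabilizer characterisation of stabilizerStates (Aaronson–Gottesman) for the
projection step; shared with ExactGadgetTransfer and with Dequantize 0244/0470. Edge cases: δ ≥ 1
makes the left side 0 (φ = 0); δ < 0 behaves as |δ| (definition uses δ²). [MehrabanTahmasbi2024 =
arXiv:2305.10277 §3.3 Lemmas 3.6-3.8 (pp.14-15); BravyiGosset2016 §II; BravyiEtAl2019 §2.3.1;
AaronsonGottesman2004 §III] -/
@[route_item "route-QuantumAdvantage-FermionicMagic"]
def ApproxGadgetTransfer : Prop :=
  ∀ (N : ℕ) (U : Literature.Computability.Cryptography.QCircuit Literature.Computability.Cryptography.cliffordT N), U.IsOracleFree → ∀ (A : Language Bool) (δ : ℝ), Literature.Computability.QuantumComplexity.approxStabilizerRank δ (U.toMatrix A *ᵥ Literature.Computability.Cryptography.zeroState N) ≤ Literature.Computability.QuantumComplexity.approxStabilizerRank δ (Literature.Computability.QuantumComplexity.tensorPow Literature.Computability.QuantumComplexity.magicT U.tCount)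

/-- item stmt-QuantumAdvantage-2480 · support · rank 6 · closed · moot by None · by planner
sources: MehrabanTahmasbi2024 = arXiv:2305.10277 §3.4 step (a), AaronsonGottesman2004 §III
[support] Removing clean ancillas does not lower approximate rank: χ_δ(ψ) ≤ χ_δ(ψ ⊗ |0^m⟩) for every
ψ : QReg n → ℂ, m, δ (MT24 §3.4 step (a)). Proof: if Φ = Σ_{i<r} c_i φ_i is within δ of ψ⊗|0^m⟩
(normSq ≤ δ²), restrict to the ancilla-zero block: Φ'(y) = Φ(y ++ 0^m); each φ_i(· ++ 0^m) is 0 or a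
nonzero multiple of an n-qubit stabilizer state (I⊗⟨0^m| maps stabilizer states to multiples of
stabilizer states), so χ(Φ') ≤ r, and normSq(ψ − Φ') ≤ normSq(ψ⊗0^m − Φ) ≤ δ². Uses
`tensorVec`/`Fin.castAdd`/`Fin.natAdd` bookkeeping and the stabilizer projection fact (shared with
ApproxGadgetTransfer). [MehrabanTahmasbi2024 = arXiv:2305.10277 §3.4 (a), p.15;
AaronsonGottesman2004 §III] -/
@[route_item "route-QuantumAdvantage-FermionicMagic"]
def AncillaDrop : Prop :=
  ∀ (n m : ℕ) (ψ : Literature.Computability.Cryptography.QReg n → ℂ) (δ : ℝ), Literature.Computability.QuantumComplexity.approxStabilizerRank δ ψ ≤ Literature.Computability.QuantumComplexity.approxStabilizerRank δ (Literature.Computability.Cryptography.tensorVec ψ (Literature.Computability.Cryptography.zeroState m))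

/-- item stmt-QuantumAdvantage-2481 · support · rank 7 · closed · moot by None · by planner
sources: BravyiEtAl2019 = arXiv:1808.00128 §2 (definition of χ_δ), tree: approxStabilizerRank, normSq
[support] Perturbation/triangle inequality for χ_δ over the tree's definition (normSq = Σ‖·‖², sInf
over {r | ∃ φ, normSq(ψ−φ) ≤ δ² ∧ χ(φ) = r}): for δ, ε ≥ 0 and normSq(ψ − ψ') ≤ ε², χ_{δ+ε}(ψ) ≤
χ_δ(ψ'). Proof: the defining set for ψ' is nonempty (φ = ψ'), so χ_δ(ψ') = χ(φ*) for some φ* with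
normSq(ψ'−φ*) ≤ δ²; by Minkowski on QReg n → ℂ (EuclideanSpace / `norm_add_le` after `Real.sqrt`),
normSq(ψ−φ*) ≤ (ε+δ)², hence χ_{δ+ε}(ψ) ≤ χ(φ*). Routine; used by the Assembly with δ = ε = δ₀/2.
[BravyiEtAl2019 §2 Def. 3 (χ_δ); folklore] -/
@[route_item "route-QuantumAdvantage-FermionicMagic"]
def ApproxRankPerturb : Prop :=
  ∀ (n : ℕ) (ψ ψ' : Literature.Computability.Cryptography.QReg n → ℂ) (δ ε : ℝ), 0 ≤ δ → 0 ≤ ε → Literature.Computability.Cryptography.normSq (ψ - ψ') ≤ ε ^ 2 → Literature.Computability.QuantumComplexity.approxStabilizerRank (δ + ε) ψ ≤ Literature.Computability.QuantumComplexity.approxStabilizerRank δ ψ'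

/-- item stmt-QuantumAdvantage-2482 · support · rank 8 · closed · moot by None · by planner
sources: JiangEtAl2018 = arXiv:1711.05395 §III (Slater determinant preparation by Givens rotations), KivlichanEtAl2018 = arXiv:1711.04789, VerstraeteCiracLatorre2009 = arXiv:0804.1888 (fermionic FT circuit, beam splitter F₂), Ferris2014 = arXiv:1310.7605 (FFFT), RossSelinger2016 = arXiv:1403.2975, DawsonNielsen2006 (Solovay–Kitaev); tree: Literature.Computability.QuantumComplexity.exists_placementWord (PlacementSolovayKitaev.lean:514)
[support] Polynomial-T-count approximate preparation of the ring Fermi sea: ∀ ε > 0 ∃ a ∀ n ∃ m and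
an oracle-free Clifford+T circuit U on n+m wires with tCount U ≤ a(n+1)^a and normSq(FS_n ⊗ |0^m⟩ −
U|0^{n+m}⟩) ≤ ε², FS_n as in FermiSeaApproxRank (FS_n : QReg n → ℂ (inlined lambda; definition
request slaterState filed): FS_n(x) = det[exp(2πi·a·j_b/n)/√n]_{a,b<k}, k = ⌊n/2⌋, if x has exactly
k ones, at sites j_0<…<j_{k-1} (rows a ascending, columns = occupied sites ascending;
`Finset.orderEmbOfFin`), else 0; = n^{-k/2}·∏_{b<b'}(ω^{j_{b'}}−ω^{j_b}); unit norm (Cauchy–Binet);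
= Jordan–Wigner image of ∏_{a<k} ψ†(φ_a)|vac⟩ with c_j† = Z_0⋯Z_{j-1}σ_j^+, qubit value true =
occupied (checked numerically, n = 4, 6).). In print: |1^k 0^{n−k}⟩ (X = HSSH, T-free) followed by
the fermionic Gaussian unitary of the k×n orbital matrix, decomposed into ≤ k(n−k) nearest-neighbour
Givens rotations = matchgates 1 ⊕ R(θ,φ) ⊕ phase (JiangEtAl2018 §III, KivlichanEtAl2018; or the
fermionic FFT with O(n log n) beam splitters + twiddle phases diag(1, ω_n^j) for n = 2^s,
VerstraeteCiracLatorre2009, Ferris2014); each non-Clifford one/two-qubit block is replaced by a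
Clifford+T word of length O(log^c((n²)/ε)) -/
@[route_item "route-QuantumAdvantage-FermionicMagic"]
def FermiSeaPrep : Prop :=
  ∀ ε : ℝ, 0 < ε → ∃ a : ℕ, ∀ n : ℕ, ∃ (m : ℕ) (U : Literature.Computability.Cryptography.QCircuit Literature.Computability.Cryptography.cliffordT (n + m)), U.IsOracleFree ∧ U.tCount ≤ a * (n + 1) ^ a ∧ Literature.Computability.Cryptography.normSq (Literature.Computability.Cryptography.tensorVec (fun x : Literature.Computability.Cryptography.QReg n => if h : (Finset.univ.filter fun j : Fin n => x j = true).card = n / 2 then (Matrix.of fun a b : Fin (n / 2) => Complex.exp (2 * (Real.pi : ℂ) * Complex.I * ((a : ℕ) : ℂ) * ((((Finset.univ.filter fun j : Fin n => x j = true).orderEmbOfFin h b : Fin n) : ℕ) : ℂ) / (n : ℂ)) / (Real.sqrt (n : ℝ) : ℂ)).det else 0) (Literature.Computability.Cryptography.zeroState m) - U.toMatrix 0 *ᵥ Literature.Computability.Cryptography.zeroState (n + m)) ≤ ε ^ 2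

/-- item stmt-QuantumAdvantage-2483 · support · rank 9 · closed · moot by None · by planner
sources: VerstraeteCiracLatorre2009 = arXiv:0804.1888, JozsaMiyake2008 = arXiv:0804.4050, KivlichanEtAl2018 = arXiv:1711.04789, GilesSelinger2013 = arXiv:1212.0506, planner check: folder check_gates.py (CH and G_H identities exact; Slater conventions r=2,3)
[support] EXACT Clifford+T preparation of the hypercube Fermi sea with T-count ≤ (r+1)·2^{r+1}: ∀ r
∃ oracle-free U : QCircuit cliffordT (2^r) with U|0^{2^r}⟩ = CS_r exactly (CS_r as in
CubeSeaExactRank: CS_r : QReg (2^r) → ℂ (inlined lambda): sites j ∈ Fin 2^r read as r-bit strings, K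
= {a : 2·popcount(a) < r} ascending (popcount via `(Nat.digits 2 a).sum`, a·j via `Nat.land`),
CS_r(x) = det[(−1)^{popcount(a_p AND j_q)}/√(2^r)]_{p,q<|K|} if x has exactly |K| ones at sites
j_0<…, else 0; r odd ⇒ |K| = 2^{r−1} (half filling; unique ground state of hopping on the hypercube
Q_r, BernardCrampeVinet2023); amplitudes = |K|×|K| minors of the Sylvester–Hadamard matrix over
2^{r|K|/2}, nonzero iff the occupied set is unisolvent for multilinear polynomials of degree < r/2
(r = 3: support 58/70, |amp| ∈ {1/8, 1/4}; checked numerically r = 2, 3).). Construction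
(planner-verified numerically, check_gates.py): (1) X on the sites a ∈ K (X = H S S H); (2) the
fermionic Walsh–Hadamard transform Γ(H^{⊗r}) = ∏_{i<r} ∏_{pairs {j, j⊕e_i}} (two-mode Hadamard beam
splitter), r·2^{r−1} beam splitters; by functoriality of Slater determinants (Γ(V)∏ψ†(φ_a)|vac⟩ =
∏ψ†(Vφ_a)|vac⟩, Γ(V)|vac⟩ = |vac⟩) the outpu -/
@[route_item "route-QuantumAdvantage-FermionicMagic"]
def CubeSeaPrep : Prop :=
  ∀ r : ℕ, ∃ U : Literature.Computability.Cryptography.QCircuit Literature.Computability.Cryptography.cliffordT (2 ^ r), U.IsOracleFree ∧ U.tCount ≤ (r + 1) * 2 ^ (r + 1) ∧ U.toMatrix 0 *ᵥ Literature.Computability.Cryptography.zeroState (2 ^ r) = (fun x : Literature.Computability.Cryptography.QReg (2 ^ r) => if h : (Finset.univ.filter fun j : Fin (2 ^ r) => x j = true).card = (Finset.univ.filter fun a : Fin (2 ^ r) => 2 * (Nat.digits 2 (a : ℕ)).sum < r).card then (Matrix.of fun p q => (-1 : ℂ) ^ (Nat.digits 2 ((((Finset.univ.filter fun a : Fin (2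 ^ r) => 2 * (Nat.digits 2 (a : ℕ)).sum < r).orderEmbOfFin rfl p : Fin (2 ^ r)) : ℕ) &&& (((Finset.univ.filter fun j : Fin (2 ^ r) => x j = true).orderEmbOfFin h q : Fin (2 ^ r)) : ℕ))).sum / (Real.sqrt (2 ^ r : ℝ) : ℂ)).det else 0)

/-- item stmt-QuantumAdvantage-2484 · support · rank 10 · closed · moot by None · by planner
sources: BravyiGosset2016 = arXiv:1601.07601 §II, BravyiEtAl2019 = arXiv:1808.00128 §2.3.1 eq.(16), tree fact: BravyiGosset2016_stabilizerRank_output_le (StabilizerSimulation.lean:171)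
[support] Exact gadgetization bound (Bravyi–Gosset 2016 §II; BBCCGH 2019 §2.3.1 eq.(16)): for an
oracle-free Clifford+T circuit U on N wires and a basis state |y⟩, χ(U|y⟩) ≤ χ(|T⟩^{⊗ tCount U}):
U|y⟩ = 2^{t/2}(1⊗⟨0^t|) C (|y⟩⊗|T⟩^{⊗t}) with C Clifford, and Clifford unitaries / ⟨0|-projections
map stabilizer states to stabilizer states or 0. SAME STATEMENT as the tree's named fact
Literature.Computability.QuantumComplexity.BravyiGosset2016_stabilizerRank_output_le
(StabilizerSimulation.lean:171) — restated here so that this route file does not import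
StabilizerSimulation.lean (whose other facts are unproved and would block the route's import cone);
whoever proves one should discharge the other (`theorem …_holds`). [BravyiGosset2016 =
arXiv:1601.07601 §II; BravyiEtAl2019 = arXiv:1808.00128 §2.3.1 eq.(16)] -/
@[route_item "route-QuantumAdvantage-FermionicMagic"]
def ExactGadgetTransfer : Prop :=
  ∀ (N : ℕ) (U : Literature.Computability.Cryptography.QCircuit Literature.Computability.Cryptography.cliffordT N), U.IsOracleFree → ∀ (A : Language Bool) (y : Literature.Computability.Cryptography.QReg N), Literature.Computability.QuantumComplexity.stabilizerRank (U.toMatrix A *ᵥ Literature.Computability.Cryptography.basisState y) ≤ Literature.Computability.QuantumComplexity.stabilizerRank (Literature.Computability.QuantumComplexity.tensorPow Literature.Computability.QuantumComplexity.magicT U.tCount)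

/-- item stmt-QuantumAdvantage-1794 · support · rank 11 · open · by planner
why it might fail: Could be false only together with perm ∈ P/poly-type collapses (MT24 Thm 1.6), but unconditionally nothing beyond ~quadratic is known; listed as support (special case of the target).
sources: MehrabanTahmasbi2024 = arXiv:2305.10277 Thm 1.1, Thm 1.6, PelegShpilkaVolk2022 = arXiv:2106.03214 Thm 1.1, QassimPashayanGosset2021 = arXiv:2106.07740
[crux] S-SIDE CLASSICAL CORE: superpolynomial EXACT stabilizer rank of |T⟩^{⊗t} over ℂ, typed over
the landed StabilizerRank.lean: ∀ c ∃ t, t^c + c < stabilizerRank (tensorPow magicT t). The δ = 0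
shadow of Dequantize's kill item 0247 (which asks it for some δ ∈ (0,1) and is STRONGER:
approxStabilizerRank_le_stabilizerRank); previously unfiled on the hub although it is the best-known
open problem of the area (superlinear is open). Inside this route it is the archimedean face of
ModularRankSuperpoly (support ModularToExact via the transfer lemma). Note for provers:
stabilizerRank is an sInf, so any lower bound needs nonemptiness of the decomposition set
(computational basis states are stabilizer states: X = H·S·S·H). -/
@[route_item "route-QuantumAdvantage-FermionicMagic"]
def NegExactStabrankPoly : Prop :=
  ∀ c : ℕ, ∃ t : ℕ, t ^ c + c < Literature.Computability.QuantumComplexity.stabilizerRank (Literature.Computability.QuantumComplexity.tensorPow Literature.Computability.QuantumComplexity.magicT t)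

/-- item stmt-QuantumAdvantage-2485 · support · rank 12 · closed · moot by None · by planner
sources: planner sketch: Sketch.lean exactHorn_composes
[support] Glue of the exact horn: CubeSeaExactRank → ExactGadgetTransfer → CubeSeaPrep →
NegExactStabrankPoly. Pure logic + arithmetic (t_r ≤ (r+1)2^{r+1} ≤ (2^r)^3 for r ≥ 1, so t_r^c + c
≤ (2^r)^{3c+2} for r ≥ c+1; take t := tCount U_r and basisState (fun _ => false) = zeroState).
PROVED in the planner's sketch (folder Sketch.lean, theorem exactHorn_composes, rc 0) — attached as
evidence; a prover only needs to transcribe it into Theorems/. -/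
@[route_item "route-QuantumAdvantage-FermionicMagic"]
def ExactHorn : Prop :=
  CubeSeaExactRank → ExactGadgetTransfer → CubeSeaPrep → NegExactStabrankPoly

/-- item stmt-QuantumAdvantage-2486 · support · rank 13 · closed · moot by None · by planner
sources: planner sketch: Sketch.lean cubeHorn_composes, MehrabanTahmasbi2024 = arXiv:2305.10277 §3.4 (shape of the argument)
[support] Glue of the cube (approximate) line to the target: ApproxGadgetTransfer → CubeSeaPrep →
CubeSeaApproxRank → NegStabrankSuperpoly, with the SAME δ (exact preparation: χ_δ(CS_r) =
χ_δ(U_r|0⟩) ≤ χ_δ(|T⟩^{⊗ t_r}), t_r ≤ (r+1)2^{r+1}). PROVED in the planner's sketch (theorem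
cubeHorn_composes, rc 0) — attached as evidence. -/
@[route_item "route-QuantumAdvantage-FermionicMagic"]
def CubeHorn : Prop :=
  ApproxGadgetTransfer → CubeSeaPrep → CubeSeaApproxRank → NegStabrankSuperpoly

/-- item stmt-QuantumAdvantage-2487 · assembly · rank 1 · closed · moot by None · by planner
sources: planner sketch: Sketch.lean assembly_composes, MehrabanTahmasbi2024 = arXiv:2305.10277 §3.4
[assembly] ApproxGadgetTransfer → AncillaDrop → ApproxRankPerturb → FermiSeaPrep →
FermiSeaApproxRank → NegStabrankSuperpoly. Proof (PROVED in the planner's sketch, theorem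
assembly_composes, rc 0, attached as evidence): from X get δ₀; set δ := δ₀/2; given c, FermiSeaPrep
at ε := δ₀/2 gives a; arithmetic gives k, N with t ≤ a(n+1)^a ⇒ t^c + c ≤ n^k for n ≥ N (k =
(2a+1)c+2, N = a+c+2); X gives n ≥ N with n^k < χ_{δ₀}(FS_n) ≤ χ_{δ₀}(FS_n⊗0^m) [AncillaDrop] ≤
χ_{δ₀/2}(U|0⟩) [ApproxRankPerturb with δ = ε = δ₀/2, add_halves] ≤ χ_{δ₀/2}(|T⟩^{⊗ tCount U})
[ApproxGadgetTransfer, A := 0]; take t := tCount U. [MehrabanTahmasbi2024 §3.4] -/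
@[route_item "route-QuantumAdvantage-FermionicMagic"]
def Assembly : Prop :=
  ApproxGadgetTransfer → AncillaDrop → ApproxRankPerturb → FermiSeaPrep → FermiSeaApproxRank → NegStabrankSuperpoly

end Summit.QuantumAdvantage.QuantumAdvantage.Theses.FermionicMagic
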